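import Mathlib
import Summits.CriticalPhenomena.CardyFormulaZ2.Theorems.CardyMagicRigidityDefs
import Summits.CriticalPhenomena.CardyFormulaZ2.Theorems.CardyMagicRigidityNestingRigidityTowerCountMeasurable
import Summits.CriticalPhenomena.CardyFormulaZ2.Theorems.CardyMagicRigidityNestingRigidityTowerPressureSanity
import HarnessLib

/-!
# Stub S4b `stub_tiltUniqueness` (line `ring-cloud-tomography`, crux `NestingRigidity`)

Crux `Summit.CriticalPhenomena.CardyFormulaZ2.Theses.CardyMagicRigidity.NestingRigidity`
(stmt-CriticalPhenomena-4835), line `ring-cloud-tomography`, registered stub `stub_tiltUniqueness`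
(S4b, the provable last step of S4 `TowerLaw`): asymptotic agreement, as `δ → 0⁺`, of the positively
TILTED one-point tower moments `E[∏ⱼ uⱼ^{N_x(ρⱼ,R)}]` of bond-`ℤ²` and site-`𝕋` for every weight
vector `u` in the open box `(0,1)^m` forces asymptotic agreement of every cylinder probability
`P[∀ j, N_x(ρⱼ,R) = kⱼ]`, i.e. `TowerStatisticsAgree`.

The proof is elementary and quantitative (no compactness, no series, no dominated convergence):

* §1 `tendsto_coeff_of_peel` — ONE-VARIABLE PEELING IN LIMIT FORM: if `F_i(t) → 0` along a filter
  for every `t ∈ (0,1)` and `|F_i(t) − Σ_{n ≤ j} tⁿ a_i(n)| ≤ C t^{j+1}` for all `i, j, t`, then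
  every coefficient `a_i(j) → 0` (strong induction on `j`: `tʲ|a_i(j)| ≤ |F_i(t)| +
  Σ_{n<j} tⁿ|a_i(n)| + C t^{j+1}`, so `limsup |a_i(j)| ≤ C t` for every `t`, hence `0`).
* §2 `abs_integral_sub_partialSum_le` — on ONE probability space, for a weight `|W| ≤ 1`, a factor
  `0 ≤ M ≤ 1` and a count `N₀ : Ω → ℕ`, the tilted moment `∫ W t^{N₀} M` differs from its partial
  sum `Σ_{n ≤ j} tⁿ ∫ W 1{N₀ = n} M` by the tail `∫ W t^{N₀} M 1{N₀ > j}`, of modulus `≤ t^{j+1}`.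
* §3 `tendsto_cylinder_of_tendsto_tilt` — induction on the number `m` of counts, for two probability
  spaces, measurable weights `|W|, |W'| ≤ 1` and measurable count vectors `N, N' : Ω → ℕ^m`: if the
  weighted tilted moments `∫ W ∏ⱼ uⱼ^{Nⱼ} − ∫ W' ∏ⱼ uⱼ^{N'ⱼ} → 0` for all `u ∈ (0,1)^m`, then
  `∫ W 1{N = k} − ∫ W' 1{N' = k} → 0` for every `k` (peel the first count with §1–§2 applied to the
  weight `W ∏_{j ≥ 1} uⱼ^{Nⱼ}`, then recurse with the new weight `W 1{N₀ = k₀}`).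
* §4 the stub: `W = 1`, `N_j = towerCount (E.X δ ·) x (ρ j) R` (measurable: `measurable_towerCount`,
  p72444; probability laws: `isProbabilityMeasure_of_mem`, p72271), filter `𝓝[>] 0`.
-/

noncomputable section

open MeasureTheory Set Filter Metric
open scoped Real Topology BigOperators

namespace Summit.CriticalPhenomena.CardyFormulaZ2.Cruxes.NestingRigidity.RingCloudTomography

open Literature.Probability.RandomPlanarGeometry Literature.Probability.Percolation
  Literature.Probability.LatticeModels

/-! ## §1 One-variable peeling in limit form -/

/-- **One-variable peeling in limit form.** If `F i t → 0` along `l` for every `t ∈ (0,1)` and the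
partial sums `Σ_{n ≤ j} tⁿ a i n` approximate `F i t` up to `C t^{j+1}` uniformly in `i`, then every
coefficient `a i j` tends to `0` along `l`. -/
theorem tendsto_coeff_of_peel {ι : Type*} {l : Filter ι} {F : ι → ℝ → ℝ} {a : ι → ℕ → ℝ} {C : ℝ}
    (hF : ∀ t, 0 < t → t < 1 → Tendsto (fun i ↦ F i t) l (𝓝 0))
    (hrem : ∀ i j t, 0 < t → t < 1 →
      |F i t - ∑ n ∈ Finset.range (j + 1), t ^ n * a i n| ≤ C * t ^ (j + 1)) :
    ∀ j, Tendsto (fun i ↦ a i j) l (𝓝 0) := by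
  intro j
  induction j using Nat.strong_induction_on with
  | _ j ih =>
  -- limsup bound: for every `t ∈ (0,1)` and `η > 0`, eventually `|a i j| ≤ C t + η`
  have key : ∀ t, 0 < t → t < 1 → ∀ η, 0 < η → ∀ᶠ i in l, |a i j| ≤ C * t + η := by
    intro t ht0 ht1 η hη
    have hS : Tendsto (fun i ↦ ∑ n ∈ Finset.range j, t ^ n * a i n) l (𝓝 0) := by
      have hS' := tendsto_finsetSum (Finset.range j)
        (fun n hn ↦ (ih n (Finset.mem_range.1 hn)).const_mul (t ^ n))
      simpa using hS'
    have hpos : 0 < η * t ^ j / 2 := by positivity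
    filter_upwards [Metric.tendsto_nhds.1 (hF t ht0 ht1) _ hpos, Metric.tendsto_nhds.1 hS _ hpos]
      with i h1 h2
    rw [Real.dist_0_eq_abs] at h1 h2
    have h3 := hrem i j t ht0 ht1
    have e : t ^ j * a i j = (F i t - ∑ n ∈ Finset.range j, t ^ n * a i n) -
        (F i t - ∑ n ∈ Finset.range (j + 1), t ^ n * a i n) := by
      rw [Finset.sum_range_succ]; ring
    have h4 : |t ^ j * a i j| ≤ t ^ j * (C * t + η) := by
      rw [e]
      calc |F i t - ∑ n ∈ Finset.range j, t ^ n * a i n -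
              (F i t - ∑ n ∈ Finset.range (j + 1), t ^ n * a i n)|
          ≤ |F i t - ∑ n ∈ Finset.range j, t ^ n * a i n| +
              |F i t - ∑ n ∈ Finset.range (j + 1), t ^ n * a i n| := abs_sub _ _
        _ ≤ |F i t| + |∑ n ∈ Finset.range j, t ^ n * a i n| + C * t ^ (j + 1) :=
            add_le_add (abs_sub _ _) h3
        _ ≤ η * t ^ j / 2 + η * t ^ j / 2 + C * t ^ (j + 1) := by linarith
        _ = t ^ j * (C * t + η) := by ring
    rw [abs_mul, abs_of_pos (pow_pos ht0 j)] at h4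
    exact le_of_mul_le_mul_left h4 (pow_pos ht0 j)
  rw [Metric.tendsto_nhds]
  intro ε hε
  have h1 : ∀ᶠ t in 𝓝[>] (0 : ℝ), C * t < ε / 2 := by
    have hc : Tendsto (fun t : ℝ ↦ C * t) (𝓝 0) (𝓝 (C * 0)) := tendsto_const_nhds.mul tendsto_id
    rw [mul_zero] at hc
    exact (tendsto_nhdsWithin_of_tendsto_nhds hc).eventually (eventually_lt_nhds (by positivity))
  obtain ⟨t, ht, ht'⟩ := (h1.and (Ioo_mem_nhdsGT one_pos)).exists
  filter_upwards [key t ht'.1 ht'.2 (ε / 2) (by positivity)] with i hi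
  rw [Real.dist_0_eq_abs]
  linarith

/-! ## §2 One probability space: peeling off the first count -/

/-- A weight of modulus `≤ 1` times a `{0,1}`-valued indicator still has modulus `≤ 1`. -/
theorem abs_mul_ite_le_one {w : ℝ} {p : Prop} {_ : Decidable p} (hw : |w| ≤ 1) :
    |w * if p then (1 : ℝ) else 0| ≤ 1 := by
  split_ifs <;> simp [hw]

/-- **The tail estimate on one probability space.** For a measurable weight `|W| ≤ 1`, a measurable
factor `0 ≤ M ≤ 1`, a measurable count `N₀` and `t ∈ [0,1]`, the tilted moment `∫ W t^{N₀} M`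
differs from its `j`-th partial sum `Σ_{n ≤ j} tⁿ ∫ W 1{N₀ = n} M` by at most `t^{j+1}` (the
difference is the integral of `W t^{N₀} M 1{N₀ > j}`). -/
theorem abs_integral_sub_partialSum_le {Ω : Type*} [MeasurableSpace Ω] (P : Measure Ω)
    [IsProbabilityMeasure P] {W M : Ω → ℝ} {N₀ : Ω → ℕ} (hW : Measurable W) (hM : Measurable M)
    (hN₀ : Measurable N₀) (hW1 : ∀ ω, |W ω| ≤ 1) (hM0 : ∀ ω, 0 ≤ M ω) (hM1 : ∀ ω, M ω ≤ 1)
    {t : ℝ} (ht0 : 0 ≤ t) (ht1 : t ≤ 1) (j : ℕ) :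
    |(∫ ω, W ω * (t ^ N₀ ω * M ω) ∂P) -
        ∑ n ∈ Finset.range (j + 1), t ^ n * ∫ ω, (W ω * if N₀ ω = n then 1 else 0) * M ω ∂P|
      ≤ t ^ (j + 1) := by
  -- the tail `W t^{N₀} M 1{N₀ > j}`
  set T : Ω → ℝ := fun ω ↦ if j < N₀ ω then W ω * (t ^ N₀ ω * M ω) else 0 with hT
  have hpt : ∀ ω, W ω * (t ^ N₀ ω * M ω) =
      (∑ n ∈ Finset.range (j + 1), t ^ n * ((W ω * if N₀ ω = n then 1 else 0) * M ω)) + T ω := by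
    intro ω
    have e : ∀ n, t ^ n * ((W ω * if N₀ ω = n then 1 else 0) * M ω) =
        if N₀ ω = n then W ω * (t ^ N₀ ω * M ω) else 0 := fun n ↦ by
      split_ifs with h
      · rw [← h]; ring
      · ring
    simp only [e, Finset.sum_ite_eq, Finset.mem_range, hT]
    split_ifs <;> first | omega | ring
  -- every bounded measurable real function is integrable
  have hbdd : ∀ {f : Ω → ℝ}, Measurable f → (∀ ω, |f ω| ≤ 1) → Integrable f P := fun hf hf1 ↦
    Integrable.of_bound hf.aestronglyMeasurable 1 (Eventually.of_forall fun ω ↦ by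
      rw [Real.norm_eq_abs]; exact hf1 ω)
  have hIte : ∀ n : ℕ, Measurable fun ω ↦ (W ω * if N₀ ω = n then (1 : ℝ) else 0) * M ω := fun n ↦
    (hW.mul (Measurable.ite (hN₀ (measurableSet_singleton n)) measurable_const
      measurable_const)).mul hM
  have hIte1 : ∀ (n : ℕ) (ω : Ω), |(W ω * if N₀ ω = n then (1 : ℝ) else 0) * M ω| ≤ 1 :=
    fun n ω ↦ by
      rw [abs_mul, abs_of_nonneg (hM0 ω)]
      exact mul_le_one₀ (abs_mul_ite_le_one (hW1 ω)) (hM0 ω) (hM1 ω)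
  have hI1 : ∀ n ∈ Finset.range (j + 1),
      Integrable (fun ω ↦ t ^ n * ((W ω * if N₀ ω = n then 1 else 0) * M ω)) P :=
    fun n _ ↦ (hbdd (hIte n) (hIte1 n)).const_mul _
  have hTb : ∀ ω, |T ω| ≤ t ^ (j + 1) := by
    intro ω
    simp only [hT]
    split_ifs with h
    · rw [abs_mul, abs_mul, abs_of_nonneg (pow_nonneg ht0 _), abs_of_nonneg (hM0 ω)]
      calc |W ω| * (t ^ N₀ ω * M ω) ≤ 1 * (t ^ (j + 1) * 1) :=
            mul_le_mul (hW1 ω) (mul_le_mul (pow_le_pow_of_le_one ht0 ht1 (Nat.succ_le_of_lt h))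
              (hM1 ω) (hM0 ω) (pow_nonneg ht0 _)) (mul_nonneg (pow_nonneg ht0 _) (hM0 ω))
              zero_le_one
        _ = t ^ (j + 1) := by ring
    · rw [abs_zero]
      exact pow_nonneg ht0 _
  have hTm : Measurable T :=
    Measurable.ite (hN₀ (MeasurableSet.of_discrete : MeasurableSet {n : ℕ | j < n}))
      (hW.mul ((hN₀.const_pow t).mul hM)) measurable_const
  have hTint : Integrable T P := hbdd hTm fun ω ↦ (hTb ω).trans (pow_le_one₀ ht0 ht1)
  have hLHS : (∫ ω, W ω * (t ^ N₀ ω * M ω) ∂P) =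
      (∑ n ∈ Finset.range (j + 1), t ^ n * ∫ ω, (W ω * if N₀ ω = n then 1 else 0) * M ω ∂P) +
        ∫ ω, T ω ∂P := by
    rw [integral_congr_ae (Eventually.of_forall hpt),
      integral_add (integrable_finsetSum _ hI1) hTint, integral_finsetSum _ hI1]
    simp only [integral_const_mul]
  rw [hLHS, add_sub_cancel_left]
  calc |∫ ω, T ω ∂P| ≤ t ^ (j + 1) * P.real univ := by
        rw [← Real.norm_eq_abs]
        exact norm_integral_le_of_norm_le_const (Eventually.of_forall fun ω ↦ by
          rw [Real.norm_eq_abs]; exact hTb ω)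
    _ = t ^ (j + 1) := by rw [probReal_univ, mul_one]

/-! ## §3 Tilted moments ⇒ cylinder probabilities -/

/-- Splitting the indicator of a cylinder `{N = k}` in `ℕ^{m+1}` into first coordinate and tail. -/
theorem mul_ite_mul_ite {m : ℕ} (v k : Fin (m + 1) → ℕ) (w : ℝ) :
    (w * if v 0 = k 0 then (1 : ℝ) else 0) * (if ∀ j : Fin m, v j.succ = k j.succ then 1 else 0) =
      w * if ∀ j, v j = k j then 1 else 0 := by
  by_cases h0 : v 0 = k 0 <;> by_cases h1 : (∀ j : Fin m, v j.succ = k j.succ) <;>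
    simp [Fin.forall_fin_succ, h0, h1]

/-- **Tilted moments determine cylinder probabilities, in limit form** (induction on the number `m`
of counts). Two probability spaces, measurable weights `|W i|, |W' i| ≤ 1` and measurable count
vectors `N i : Ω → ℕ^m`, `N' i : Ω' → ℕ^m` indexed by `i`: if for every `u ∈ (0,1)^m` the weighted
tilted moments `∫ W i ∏ⱼ uⱼ^{(N i)ⱼ} ∂P − ∫ W' i ∏ⱼ uⱼ^{(N' i)ⱼ} ∂P'` tend to `0` along `l`, then so
does `∫ W i 1{N i = k} ∂P − ∫ W' i 1{N' i = k} ∂P'` for every `k ∈ ℕ^m`. -/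
theorem tendsto_cylinder_of_tendsto_tilt {ι Ω Ω' : Type*} {l : Filter ι} [MeasurableSpace Ω]
    [MeasurableSpace Ω'] {P : Measure Ω} {P' : Measure Ω'} [IsProbabilityMeasure P]
    [IsProbabilityMeasure P'] :
    ∀ (m : ℕ) {W : ι → Ω → ℝ} {W' : ι → Ω' → ℝ} {N : ι → Ω → Fin m → ℕ}
      {N' : ι → Ω' → Fin m → ℕ}, (∀ i, Measurable (W i)) → (∀ i, Measurable (W' i)) →
      (∀ i ω, |W i ω| ≤ 1) → (∀ i ω, |W' i ω| ≤ 1) →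
      (∀ i j, Measurable fun ω ↦ N i ω j) → (∀ i j, Measurable fun ω ↦ N' i ω j) →
      (∀ u : Fin m → ℝ, (∀ j, 0 < u j ∧ u j < 1) →
        Tendsto (fun i ↦ (∫ ω, W i ω * ∏ j, u j ^ N i ω j ∂P) -
          ∫ ω, W' i ω * ∏ j, u j ^ N' i ω j ∂P') l (𝓝 0)) →
      ∀ k : Fin m → ℕ,
        Tendsto (fun i ↦ (∫ ω, W i ω * (if ∀ j, N i ω j = k j then 1 else 0) ∂P) -
          ∫ ω, W' i ω * (if ∀ j, N' i ω j = k j then 1 else 0) ∂P') l (𝓝 0) := by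
  intro m
  induction m with
  | zero =>
    intro W W' N N' _ _ _ _ _ _ h k
    have h0 := h (fun _ ↦ 1 / 2) (fun _ ↦ by norm_num)
    simpa using h0
  | succ m ih =>
    intro W W' N N' hW hW' hW1 hW1' hN hN' h k
    -- the peeled weights `W · 1{N₀ = n}` are again measurable and of modulus `≤ 1`
    have hWn : ∀ (n : ℕ) (i : ι), Measurable fun ω ↦ W i ω * if N i ω 0 = n then (1 : ℝ) else 0 :=
      fun n i ↦ (hW i).mul (Measurable.ite (hN i 0 (measurableSet_singleton n)) measurable_const
        measurable_const)
    have hWn' : ∀ (n : ℕ) (i : ι),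
        Measurable fun ω ↦ W' i ω * if N' i ω 0 = n then (1 : ℝ) else 0 :=
      fun n i ↦ (hW' i).mul (Measurable.ite (hN' i 0 (measurableSet_singleton n)) measurable_const
        measurable_const)
    have hWn1 : ∀ (n : ℕ) (i : ι) (ω : Ω), |W i ω * if N i ω 0 = n then (1 : ℝ) else 0| ≤ 1 :=
      fun n i ω ↦ abs_mul_ite_le_one (hW1 i ω)
    have hWn1' : ∀ (n : ℕ) (i : ι) (ω : Ω'), |W' i ω * if N' i ω 0 = n then (1 : ℝ) else 0| ≤ 1 :=
      fun n i ω ↦ abs_mul_ite_le_one (hW1' i ω)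
    -- Step 1: peel off the first count (§1 + §2)
    have step : ∀ u' : Fin m → ℝ, (∀ j, 0 < u' j ∧ u' j < 1) → ∀ n : ℕ,
        Tendsto (fun i ↦
          (∫ ω, (W i ω * if N i ω 0 = n then 1 else 0) * ∏ j, u' j ^ N i ω j.succ ∂P) -
            ∫ ω, (W' i ω * if N' i ω 0 = n then 1 else 0) * ∏ j, u' j ^ N' i ω j.succ ∂P')
          l (𝓝 0) := by
      intro u' hu'
      have hM : ∀ i, Measurable fun ω ↦ ∏ j, u' j ^ N i ω j.succ := fun i ↦
        Finset.measurable_prod _ fun j _ ↦ (hN i j.succ).const_pow (u' j)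
      have hM' : ∀ i, Measurable fun ω ↦ ∏ j, u' j ^ N' i ω j.succ := fun i ↦
        Finset.measurable_prod _ fun j _ ↦ (hN' i j.succ).const_pow (u' j)
      have hM0 : ∀ i ω, 0 ≤ ∏ j, u' j ^ N i ω j.succ := fun i ω ↦
        Finset.prod_nonneg fun j _ ↦ pow_nonneg (hu' j).1.le _
      have hM0' : ∀ i ω, 0 ≤ ∏ j, u' j ^ N' i ω j.succ := fun i ω ↦
        Finset.prod_nonneg fun j _ ↦ pow_nonneg (hu' j).1.le _
      have hM1 : ∀ i ω, ∏ j, u' j ^ N i ω j.succ ≤ 1 := fun i ω ↦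
        Finset.prod_le_one (fun j _ ↦ pow_nonneg (hu' j).1.le _) fun j _ ↦
          pow_le_one₀ (hu' j).1.le (hu' j).2.le
      have hM1' : ∀ i ω, ∏ j, u' j ^ N' i ω j.succ ≤ 1 := fun i ω ↦
        Finset.prod_le_one (fun j _ ↦ pow_nonneg (hu' j).1.le _) fun j _ ↦
          pow_le_one₀ (hu' j).1.le (hu' j).2.le
      refine tendsto_coeff_of_peel (C := 2)
        (F := fun i t ↦ (∫ ω, W i ω * (t ^ N i ω 0 * ∏ j, u' j ^ N i ω j.succ) ∂P) -
          ∫ ω, W' i ω * (t ^ N' i ω 0 * ∏ j, u' j ^ N' i ω j.succ) ∂P') ?_ ?_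
      · intro t ht0 ht1
        have hu : ∀ j, 0 < Matrix.vecCons t u' j ∧ Matrix.vecCons t u' j < 1 := fun j ↦ by
          refine Fin.cases ?_ (fun j ↦ ?_) j
          · simpa using And.intro ht0 ht1
          · simpa using hu' j
        simpa only [Fin.prod_univ_succ, Matrix.cons_val_zero, Matrix.cons_val_succ] using
          h (Matrix.vecCons t u') hu
      · intro i j t ht0 ht1
        have eZ := abs_integral_sub_partialSum_le P (hW i) (hM i) (hN i 0) (hW1 i) (hM0 i) (hM1 i)
          ht0.le ht1.le j
        have eT := abs_integral_sub_partialSum_le P' (hW' i) (hM' i) (hN' i 0) (hW1' i) (hM0' i)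
          (hM1' i) ht0.le ht1.le j
        simp only [mul_sub, Finset.sum_sub_distrib]
        rw [abs_le] at eZ eT ⊢
        constructor <;> linarith [eZ.1, eZ.2, eT.1, eT.2]
    -- Step 2: recurse on the remaining `m` counts with the peeled weight `W · 1{N₀ = k 0}`
    refine (ih (hWn (k 0)) (hWn' (k 0)) (hWn1 (k 0)) (hWn1' (k 0)) (fun i j ↦ hN i j.succ)
      (fun i j ↦ hN' i j.succ) (fun u hu ↦ step u hu (k 0)) (fun j ↦ k j.succ)).congr fun i ↦ ?_
    rw [integral_congr_ae (Eventually.of_forall fun ω ↦ mul_ite_mul_ite (N i ω) k (W i ω)),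
      integral_congr_ae (Eventually.of_forall fun ω ↦ mul_ite_mul_ite (N' i ω) k (W' i ω))]

/-! ## §4 The stub -/

/-- The cylinder event of the tower-count vector is measurable on both lattice ensembles. -/
theorem measurableSet_towerCount_cylinder :
    ∀ E ∈ latticeEnsembles, ∀ (δ : ℝ) (x : ℂ) {m : ℕ} (ρ : Fin m → ℝ) (R : ℝ) (k : Fin m → ℕ),
      MeasurableSet {ω | ∀ j, towerCount (E.X δ ω) x (ρ j) R = k j} := by
  intro E hE δ x m ρ R k
  rw [Set.setOf_forall]
  exact MeasurableSet.iInter fun j ↦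
    measurable_towerCount E hE δ x (ρ j) R (measurableSet_singleton (k j))

/-- The integral of the `{0,1}`-valued indicator of a measurable event is its probability. -/
theorem integral_ite_eq_toReal_measure {Ω : Type*} [MeasurableSpace Ω] (P : Measure Ω)
    {p : Ω → Prop} {hd : DecidablePred p} (hp : MeasurableSet {ω | p ω}) :
    ∫ ω, @ite ℝ (p ω) (hd ω) 1 0 ∂P = (P {ω | p ω}).toReal := by
  rw [← measureReal_def, ← integral_indicator_one hp]
  refine integral_congr_ae (Eventually.of_forall fun ω ↦ ?_)
  by_cases h : p ω <;> simp [h]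

/-- **S4b · TiltUniqueness** (registered stub of line `ring-cloud-tomography`): asymptotic agreement
of the positively tilted one-point tower moments `E[∏ⱼ uⱼ^{N_x(ρⱼ,R)}]` of bond-`ℤ²` and site-`𝕋` on
the open box `u ∈ (0,1)^m` forces asymptotic agreement of every cylinder probability of the count
vector `(N_x(ρⱼ,R))ⱼ`, i.e. `TowerStatisticsAgree`.  Proof: `tendsto_cylinder_of_tendsto_tilt` with
trivial weights `W = W' = 1` along the filter `𝓝[>] 0` (peel one count at a time: the tail beyond
`N₀ = j` of a `t`-tilted moment is `≤ t^{j+1}`, so each coefficient is pinned in the limit). -/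
theorem stub_tiltUniqueness :
    (∀ (x : ℂ) (m : ℕ) (ρ : Fin m → ℝ) (R : ℝ) (u : Fin m → ℝ), (∀ j, 0 < ρ j) → (∀ j, ρ j < R) →
      (∀ j, 0 < u j ∧ u j < 1) →
        Tendsto (fun δ : ℝ ↦ (∫ ω, ∏ j, u j ^ towerCount (zEns.X δ ω) x (ρ j) R ∂zEns.P) -
          ∫ ω, ∏ j, u j ^ towerCount (tEns.X δ ω) x (ρ j) R ∂tEns.P) (𝓝[>] 0) (𝓝 0)) →
      TowerStatisticsAgree := by
  intro h x m ρ R k hρ hρR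
  haveI : IsProbabilityMeasure zEns.P := isProbabilityMeasure_of_mem zEns_mem
  haveI : IsProbabilityMeasure tEns.P := isProbabilityMeasure_of_mem tEns_mem
  have key := tendsto_cylinder_of_tendsto_tilt (l := 𝓝[>] (0 : ℝ)) (P := zEns.P) (P' := tEns.P) m
    (W := fun _ _ ↦ (1 : ℝ)) (W' := fun _ _ ↦ (1 : ℝ))
    (N := fun δ ω j ↦ towerCount (zEns.X δ ω) x (ρ j) R)
    (N' := fun δ ω j ↦ towerCount (tEns.X δ ω) x (ρ j) R)
    (fun _ ↦ measurable_const) (fun _ ↦ measurable_const) (fun _ _ ↦ by simp) (fun _ _ ↦ by simp)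
    (fun δ j ↦ measurable_towerCount zEns zEns_mem δ x (ρ j) R)
    (fun δ j ↦ measurable_towerCount tEns tEns_mem δ x (ρ j) R)
    (fun u hu ↦ by simpa only [one_mul] using h x m ρ R u hρ hρR hu) k
  simp only [one_mul] at key
  refine key.congr fun δ ↦ ?_
  rw [integral_ite_eq_toReal_measure zEns.P
      (measurableSet_towerCount_cylinder zEns zEns_mem δ x ρ R k),
    integral_ite_eq_toReal_measure tEns.P
      (measurableSet_towerCount_cylinder tEns tEns_mem δ x ρ R k)]

end Summit.CriticalPhenomena.CardyFormulaZ2.Cruxes.NestingRigidity.RingCloudTomography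

end
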